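import Literature.Barriers.CriticalPhenomena.LongRangeTrivialityOnZ3TreeDiagram
import HarnessLib

/-!
# The sign and the two-point ceiling of `U₄` for ferromagnetic pair interactions on `ℤ^d`:
# `-2⟨σ_xσ_y⟩⟨σ_zσ_t⟩ ≤ U₄(x,y,z,t) ≤ 0` (Lebowitz; Aizenman's double-current identity)

Sibling of `LongRangeTrivialityOnZ3TreeDiagram.lean` (barrier catalogue D-0021, sub-problem
`Ising3DConformalLimit`), companion of the generation-5 audit `LongRangeTrivialityOnZ3LocalityAudit.lean`.
That audit corrects the wording "a lower bound on `|U₄|` of the order of the tree diagram" in the block of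
`LongRangeTrivialityOnZ3` on paper; this file supplies the lattice inequality behind the correction, in the
formalism of the barrier (`LongRangeIsing.state`, every `J ≥ 0`, `β ≥ 0`, every `d`):

  `-2⟨σ_xσ_y⟩_β⟨σ_zσ_t⟩_β ≤ U₄^β(x,y,z,t) ≤ 0`, hence `|U₄^β(x,y,z,t)| ≤ 2⟨σ_xσ_y⟩_β⟨σ_zσ_t⟩_β`

(and the same with the pairings `(xz)(yt)`, `(xt)(yz)` by symmetry). Source shape: Aizenman's identity
"`U₄(x₁,…,x₄) = -2⟨σ_{x₁}σ_{x₂}⟩⟨σ_{x₃}σ_{x₄}⟩·P[{x₁,x₂} ⟷ {x₃,x₄}]`" for "any ferromagnetic system of Ising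
spins" [AizenmanCDM2020, Theorem 5.4, eq. (5.13)], of which the upper bound is Lebowitz' inequality
`U₄ ≤ 0` [Lebowitz1974]. Consequence used by the audit: for points at mutual distance `L` with
`⟨σ₀σ_x⟩ ≍ |x|^{-(1+η)}`, `|U₄| ≲ S₂(L)²` always, whereas the tree diagram is `≍ S₂(L)²·L^{1-2η}` on `ℤ³` —
so for `η < 1/2` no lower bound on `|U₄|` "of the order of the tree diagram" can hold; what non-Gaussianity
needs on the current-intersection route is `P[⟷] ≥ c`, i.e. `|U₄| ≍ S₂(L)²`.

Proof: the tree's weighted random-current identity `Z[xy]Z[zt] + Z[xz]Z[yt] + Z[xt]Z[yz] = Z[xyzt]Z[∅] + 2P`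
with `0 ≤ P ≤ Z[xy]Z[zt]` (`Literature.Probability.LatticeModels.Current.ursellFour_currentSum_identity`,
the intersection term bounded by dropping the indicator), read as `U = -2P/Z[∅]²` for the ratios
(`ursell_ratio_bounds`, the two-sided companion of the tree's `abs_ursell_ratio_le`); the finite-volume free
state of a pair interaction is such a ratio on the complete graph of `↥Λ`
(`LongRangeIsing.expectIn_spinProduct_eq_wcurrentSum_div`); box limit by `tendsto_expectIn_box`.

## References

* M. Aizenman, arXiv:2112.04248 (CDM 2020), Theorem 5.4, eq. (5.13), p. 19 [AizenmanCDM2020].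
* J. L. Lebowitz, Commun. Math. Phys. 35 (1974) 87–92 [Lebowitz1974].
* R. Panis, arXiv:2309.05797, §4.1–§4.2 [Panis2023Triviality] (the random-current setting of the tree files).
-/

noncomputable section

namespace Literature.Barriers.CriticalPhenomena

open Literature.Probability.LatticeModels Literature.Probability.Percolation Filter Finset
open _root_.Topology
open scoped symmDiff ENNReal

section Ratios

variable {V : Type*} [Fintype V] [DecidableEq V]
variable {G : SimpleGraph V} [DecidableRel G.Adj] {K : G.edgeFinset → ℝ}

/-- **Two-sided bound for the random-current Ursell ratio**: for `K ≥ 0` on a finite graph and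
`⟨σ_A⟩ := Z_K[A]/Z_K[∅]`,
`-2⟨σ_xσ_y⟩⟨σ_zσ_t⟩ ≤ ⟨σ_xσ_yσ_zσ_t⟩ - ⟨σ_xσ_y⟩⟨σ_zσ_t⟩ - ⟨σ_xσ_z⟩⟨σ_yσ_t⟩ - ⟨σ_xσ_t⟩⟨σ_yσ_z⟩ ≤ 0`
(the Ursell function is `-2P/Z[∅]²` with `0 ≤ P ≤ Z[xy]Z[zt]`).
[cite: AizenmanCDM2020, Theorem 5.4, eq. (5.13), p. 19] -/
theorem ursell_ratio_bounds (hK : ∀ e, 0 ≤ K e) (x y z t : V) :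
    -(2 * (wcurrentSum K ({x} ∆ {y}) / wcurrentSum K ∅ * (wcurrentSum K ({z} ∆ {t}) / wcurrentSum K ∅))) ≤
        wcurrentSum K ({x} ∆ ({y} ∆ ({z} ∆ {t}))) / wcurrentSum K ∅ -
          wcurrentSum K ({x} ∆ {y}) / wcurrentSum K ∅ * (wcurrentSum K ({z} ∆ {t}) / wcurrentSum K ∅) -
          wcurrentSum K ({x} ∆ {z}) / wcurrentSum K ∅ * (wcurrentSum K ({y} ∆ {t}) / wcurrentSum K ∅) -
          wcurrentSum K ({x} ∆ {t}) / wcurrentSum K ∅ * (wcurrentSum K ({y} ∆ {z}) / wcurrentSum K ∅) ∧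
      wcurrentSum K ({x} ∆ ({y} ∆ ({z} ∆ {t}))) / wcurrentSum K ∅ -
          wcurrentSum K ({x} ∆ {y}) / wcurrentSum K ∅ * (wcurrentSum K ({z} ∆ {t}) / wcurrentSum K ∅) -
          wcurrentSum K ({x} ∆ {z}) / wcurrentSum K ∅ * (wcurrentSum K ({y} ∆ {t}) / wcurrentSum K ∅) -
          wcurrentSum K ({x} ∆ {t}) / wcurrentSum K ∅ * (wcurrentSum K ({y} ∆ {z}) / wcurrentSum K ∅) ≤ 0 := by
  set W : Finset V → ℝ := fun A => wcurrentSum K A with hW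
  have hW' : ∀ A, (ecurrentSum K A).toReal = W A := fun A => toReal_ecurrentSum hK A
  have hW0 : 0 < W ∅ := wcurrentSum_empty_pos hK
  have hZtop : ∀ A, ecurrentSum K A ≠ ∞ := fun A => ecurrentSum_ne_top hK A
  -- the intersection term `P` and its bounds `0 ≤ P ≤ Z[xy] Z[zt]`
  set Pe : ℝ≥0∞ := ∑' p : Current G × Current G,
    epairWeight K ({x} ∆ {y}) ({z} ∆ {t}) p * (if z ∈ (p.1 + p.2).cluster x then 1 else 0) with hPe
  have hPle : Pe ≤ ecurrentSum K ({x} ∆ {y}) * ecurrentSum K ({z} ∆ {t}) := by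
    rw [← tsum_epairWeight]
    refine ENNReal.tsum_le_tsum fun p => ?_
    calc epairWeight K ({x} ∆ {y}) ({z} ∆ {t}) p * (if z ∈ (p.1 + p.2).cluster x then 1 else 0)
        ≤ epairWeight K ({x} ∆ {y}) ({z} ∆ {t}) p * 1 := mul_le_mul' le_rfl (by split_ifs <;> simp)
      _ = _ := mul_one _
  have hPtop : Pe ≠ ∞ := ne_top_of_le_ne_top (ENNReal.mul_ne_top (hZtop _) (hZtop _)) hPle
  set p : ℝ := Pe.toReal with hp
  have hp0 : 0 ≤ p := ENNReal.toReal_nonneg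
  have hpW : p ≤ W ({x} ∆ {y}) * W ({z} ∆ {t}) := by
    have h := ENNReal.toReal_mono (ENNReal.mul_ne_top (hZtop _) (hZtop _)) hPle
    rwa [ENNReal.toReal_mul, hW', hW'] at h
  -- the identity in `ℝ`
  have hid := congrArg ENNReal.toReal (Current.ursellFour_currentSum_identity hK x y z t)
  rw [ENNReal.toReal_add (ENNReal.add_ne_top.2 ⟨ENNReal.mul_ne_top (hZtop _) (hZtop _),
      ENNReal.mul_ne_top (hZtop _) (hZtop _)⟩) (ENNReal.mul_ne_top (hZtop _) (hZtop _)),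
    ENNReal.toReal_add (ENNReal.mul_ne_top (hZtop _) (hZtop _)) (ENNReal.mul_ne_top (hZtop _) (hZtop _)),
    ENNReal.toReal_add (ENNReal.mul_ne_top (hZtop _) (hZtop _)) (ENNReal.mul_ne_top (by simp) hPtop)] at hid
  simp only [ENNReal.toReal_mul, ENNReal.toReal_ofNat, hW'] at hid
  -- `hid : Wxy Wzt + Wxz Wyt + Wxt Wyz = WD W∅ + 2 p`
  change -(2 * (W _ / W ∅ * (W _ / W ∅))) ≤
      W _ / W ∅ - W _ / W ∅ * (W _ / W ∅) - W _ / W ∅ * (W _ / W ∅) - W _ / W ∅ * (W _ / W ∅) ∧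
    W _ / W ∅ - W _ / W ∅ * (W _ / W ∅) - W _ / W ∅ * (W _ / W ∅) - W _ / W ∅ * (W _ / W ∅) ≤ 0
  have hL : W ({x} ∆ ({y} ∆ ({z} ∆ {t}))) / W ∅ - W ({x} ∆ {y}) / W ∅ * (W ({z} ∆ {t}) / W ∅) -
      W ({x} ∆ {z}) / W ∅ * (W ({y} ∆ {t}) / W ∅) - W ({x} ∆ {t}) / W ∅ * (W ({y} ∆ {z}) / W ∅) =
      -(2 * (p * W ∅ ^ 2) / W ∅ ^ 4) := by
    field_simp
    rw [← hp] at hid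
    nlinarith [hid]
  refine ⟨?_, ?_⟩
  · rw [hL, neg_le_neg_iff]
    have e1 : 2 * (W ({x} ∆ {y}) / W ∅ * (W ({z} ∆ {t}) / W ∅)) =
        2 * (W ({x} ∆ {y}) * W ({z} ∆ {t}) * W ∅ ^ 2) / W ∅ ^ 4 := by
      field_simp
    rw [e1]
    refine div_le_div_of_nonneg_right ?_ (by positivity)
    nlinarith [mul_le_mul_of_nonneg_right hpW (sq_nonneg (W ∅))]
  · rw [hL, neg_nonpos]
    positivity

end Ratios

namespace LongRangeIsing

variable {d : ℕ} (J : Site d → Site d → ℝ) (β : ℝ)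

/-- **Finite volume**: for `β ≥ 0`, `J ≥ 0`, a finite `Λ ⊆ ℤ^d` and `x, y, z, t ∈ Λ`, with
`⟨·⟩ = ⟨·⟩_{Λ,J,0,β}`, `-2⟨σ_xσ_y⟩⟨σ_zσ_t⟩ ≤ U₄^Λ(x,y,z,t) ≤ 0` (the free state of `Λ` is a random-current
ratio on the complete graph of `↥Λ`, `expectIn_spinProduct_eq_wcurrentSum_div`; then `ursell_ratio_bounds`).
[cite: AizenmanCDM2020, Theorem 5.4, eq. (5.13), p. 19] -/
theorem ursellFour_expectIn_bounds (hβ : 0 ≤ β) (hJ : ∀ x y, 0 ≤ J x y) {Λ : Finset (Site d)}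
    {x y z t : Site d} (hx : x ∈ Λ) (hy : y ∈ Λ) (hz : z ∈ Λ) (ht : t ∈ Λ) :
    -(2 * (expectIn J Λ β 0 (spinProduct ({x} ∆ {y})) * expectIn J Λ β 0 (spinProduct ({z} ∆ {t})))) ≤
        expectIn J Λ β 0 (spinProduct ({x} ∆ ({y} ∆ ({z} ∆ {t})))) -
          expectIn J Λ β 0 (spinProduct ({x} ∆ {y})) * expectIn J Λ β 0 (spinProduct ({z} ∆ {t})) -
          expectIn J Λ β 0 (spinProduct ({x} ∆ {z})) * expectIn J Λ β 0 (spinProduct ({y} ∆ {t})) -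
          expectIn J Λ β 0 (spinProduct ({x} ∆ {t})) * expectIn J Λ β 0 (spinProduct ({y} ∆ {z})) ∧
      expectIn J Λ β 0 (spinProduct ({x} ∆ ({y} ∆ ({z} ∆ {t})))) -
          expectIn J Λ β 0 (spinProduct ({x} ∆ {y})) * expectIn J Λ β 0 (spinProduct ({z} ∆ {t})) -
          expectIn J Λ β 0 (spinProduct ({x} ∆ {z})) * expectIn J Λ β 0 (spinProduct ({y} ∆ {t})) -
          expectIn J Λ β 0 (spinProduct ({x} ∆ {t})) * expectIn J Λ β 0 (spinProduct ({y} ∆ {z})) ≤ 0 := by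
  set K := pairEdgeWeight (fun a b : ↥Λ => J a b) β with hKdef
  have hK : ∀ e, 0 ≤ K e := pairEdgeWeight_nonneg hβ fun a b => hJ a b
  have hE : ∀ A, expectIn J Λ β 0 (spinProduct A) = wcurrentSum K (inVol Λ A) / wcurrentSum K ∅ :=
    fun A => expectIn_spinProduct_eq_wcurrentSum_div J β hβ hJ Λ A
  have h4 : inVol Λ ({x} ∆ ({y} ∆ ({z} ∆ {t}))) = {⟨x, hx⟩} ∆ ({⟨y, hy⟩} ∆ ({⟨z, hz⟩} ∆ {⟨t, ht⟩})) := by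
    rw [inVol_symmDiff, inVol_symmDiff, inVol_symmDiff, inVol_singleton hx, inVol_singleton hy,
      inVol_singleton hz, inVol_singleton ht]
  rw [hE, hE, hE, hE, hE, hE, hE, h4, inVol_pair hx hy, inVol_pair hz ht, inVol_pair hx hz, inVol_pair hy ht,
    inVol_pair hx ht, inVol_pair hy hz]
  exact ursell_ratio_bounds hK ⟨x, hx⟩ ⟨y, hy⟩ ⟨z, hz⟩ ⟨t, ht⟩

/-- The finite-volume Ursell functions along boxes converge to `U₄^β` (`β ≥ 0`, `J ≥ 0`). [folklore] -/
theorem tendsto_ursellFour_expectIn_box (hβ : 0 ≤ β) (hJ : ∀ x y, 0 ≤ J x y) (x y z t : Site d) :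
    Tendsto (fun L : ℕ =>
      expectIn J (box d L) β 0 (spinProduct ({x} ∆ ({y} ∆ ({z} ∆ {t})))) -
        expectIn J (box d L) β 0 (spinProduct ({x} ∆ {y})) * expectIn J (box d L) β 0 (spinProduct ({z} ∆ {t})) -
        expectIn J (box d L) β 0 (spinProduct ({x} ∆ {z})) * expectIn J (box d L) β 0 (spinProduct ({y} ∆ {t})) -
        expectIn J (box d L) β 0 (spinProduct ({x} ∆ {t})) * expectIn J (box d L) β 0 (spinProduct ({y} ∆ {z})))
      atTop (𝓝 (ursellFour J β x y z t)) := by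
  have hT : ∀ A : Finset (Site d),
      Tendsto (fun L : ℕ => expectIn J (box d L) β 0 (spinProduct A)) atTop (𝓝 (state J β 0 (spinProduct A))) :=
    fun A => tendsto_expectIn_box J β hβ hJ A
  have h := (((hT ({x} ∆ ({y} ∆ ({z} ∆ {t})))).sub ((hT ({x} ∆ {y})).mul (hT ({z} ∆ {t})))).sub
    ((hT ({x} ∆ {z})).mul (hT ({y} ∆ {t})))).sub ((hT ({x} ∆ {t})).mul (hT ({y} ∆ {z})))
  rw [ursellFour, fourCorrelation_eq, pairCorrelation_eq, pairCorrelation_eq, pairCorrelation_eq,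
    pairCorrelation_eq, pairCorrelation_eq, pairCorrelation_eq]
  exact h

/-- **Lebowitz' inequality for the infinite-volume free state of a ferromagnetic pair interaction on `ℤ^d`**:
`U₄^β(x,y,z,t) ≤ 0` for `β ≥ 0`, `J ≥ 0` (box limit of the finite-volume sign).
[cite: Lebowitz1974] [cite: AizenmanCDM2020, Theorem 5.4, eq. (5.13), p. 19] -/
theorem ursellFour_nonpos (hβ : 0 ≤ β) (hJ : ∀ x y, 0 ≤ J x y) (x y z t : Site d) :
    ursellFour J β x y z t ≤ 0 := by
  obtain ⟨L₀, hL₀⟩ := exists_forall_subset_box d ({x, y, z, t} : Finset (Site d))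
  refine le_of_tendsto (tendsto_ursellFour_expectIn_box J β hβ hJ x y z t) (eventually_atTop.2 ⟨L₀, fun L hL => ?_⟩)
  have hsub := hL₀ L hL
  have hx : x ∈ box d L := hsub (Finset.mem_insert_self _ _)
  have hy : y ∈ box d L := hsub (Finset.mem_insert_of_mem (Finset.mem_insert_self _ _))
  have hz : z ∈ box d L := hsub (Finset.mem_insert_of_mem (Finset.mem_insert_of_mem (Finset.mem_insert_self _ _)))
  have ht : t ∈ box d L :=
    hsub (Finset.mem_insert_of_mem (Finset.mem_insert_of_mem (Finset.mem_insert_of_mem (Finset.mem_singleton_self _))))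
  exact (ursellFour_expectIn_bounds J β hβ hJ hx hy hz ht).2

/-- **The two-point ceiling of `U₄`**: `-2⟨σ_xσ_y⟩_β⟨σ_zσ_t⟩_β ≤ U₄^β(x,y,z,t)` for `β ≥ 0`, `J ≥ 0` (box
limit; the finite-volume two-point functions converge to the infinite-volume ones).
[cite: AizenmanCDM2020, Theorem 5.4, eq. (5.13), p. 19] -/
theorem neg_two_mul_pairCorrelation_le_ursellFour (hβ : 0 ≤ β) (hJ : ∀ x y, 0 ≤ J x y) (x y z t : Site d) :
    -(2 * (pairCorrelation J β x y * pairCorrelation J β z t)) ≤ ursellFour J β x y z t := by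
  have hT : ∀ A : Finset (Site d),
      Tendsto (fun L : ℕ => expectIn J (box d L) β 0 (spinProduct A)) atTop (𝓝 (state J β 0 (spinProduct A))) :=
    fun A => tendsto_expectIn_box J β hβ hJ A
  have hlow : Tendsto (fun L : ℕ =>
      -(2 * (expectIn J (box d L) β 0 (spinProduct ({x} ∆ {y})) * expectIn J (box d L) β 0 (spinProduct ({z} ∆ {t})))))
      atTop (𝓝 (-(2 * (pairCorrelation J β x y * pairCorrelation J β z t)))) := by
    rw [pairCorrelation_eq, pairCorrelation_eq]
    exact (((hT ({x} ∆ {y})).mul (hT ({z} ∆ {t}))).const_mul 2).neg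
  obtain ⟨L₀, hL₀⟩ := exists_forall_subset_box d ({x, y, z, t} : Finset (Site d))
  refine le_of_tendsto_of_tendsto hlow (tendsto_ursellFour_expectIn_box J β hβ hJ x y z t)
    (eventually_atTop.2 ⟨L₀, fun L hL => ?_⟩)
  have hsub := hL₀ L hL
  have hx : x ∈ box d L := hsub (Finset.mem_insert_self _ _)
  have hy : y ∈ box d L := hsub (Finset.mem_insert_of_mem (Finset.mem_insert_self _ _))
  have hz : z ∈ box d L := hsub (Finset.mem_insert_of_mem (Finset.mem_insert_of_mem (Finset.mem_insert_self _ _)))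
  have ht : t ∈ box d L :=
    hsub (Finset.mem_insert_of_mem (Finset.mem_insert_of_mem (Finset.mem_insert_of_mem (Finset.mem_singleton_self _))))
  exact (ursellFour_expectIn_bounds J β hβ hJ hx hy hz ht).1

/-- **`|U₄^β(x,y,z,t)| ≤ 2⟨σ_xσ_y⟩_β⟨σ_zσ_t⟩_β`** (`β ≥ 0`, `J ≥ 0`): the connected four-point function never
exceeds the disconnected two-point scale — on `ℤ³` with `⟨σ₀σ_x⟩ ≍ |x|^{-(1+η)}` and points at mutual distance
`L` this is `≲ S₂(L)²`, a factor `L^{1-2η}` BELOW the tree diagram. [cite: AizenmanCDM2020, Theorem 5.4, eq. (5.13), p. 19] -/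
theorem abs_ursellFour_le_two_mul_pairCorrelation (hβ : 0 ≤ β) (hJ : ∀ x y, 0 ≤ J x y) (x y z t : Site d) :
    |ursellFour J β x y z t| ≤ 2 * (pairCorrelation J β x y * pairCorrelation J β z t) := by
  have h1 : 0 ≤ pairCorrelation J β x y := pairCorrelation_nonneg J β hβ hJ x y
  have h2 : 0 ≤ pairCorrelation J β z t := pairCorrelation_nonneg J β hβ hJ z t
  have h0 : (0 : ℝ) ≤ 2 * (pairCorrelation J β x y * pairCorrelation J β z t) :=
    mul_nonneg (by norm_num) (mul_nonneg h1 h2)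
  have hup : ursellFour J β x y z t ≤ 2 * (pairCorrelation J β x y * pairCorrelation J β z t) :=
    (ursellFour_nonpos J β hβ hJ x y z t).trans h0
  exact abs_le.2 ⟨neg_two_mul_pairCorrelation_le_ursellFour J β hβ hJ x y z t, hup⟩

/-- `U₄` is symmetric under `y ↔ z`. [folklore] -/
theorem ursellFour_swap_yz (x y z t : Site d) : ursellFour J β x z y t = ursellFour J β x y z t := by
  have h4 : fourCorrelation J β x z y t = fourCorrelation J β x y z t := by
    rw [fourCorrelation_eq, fourCorrelation_eq, symmDiff_left_comm ({z} : Finset (Site d)) {y} {t}]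
  rw [ursellFour, ursellFour, h4, pairCorrelation_comm J β z y]
  ring

/-- `U₄` is symmetric under `y ↔ t`. [folklore] -/
theorem ursellFour_swap_yt (x y z t : Site d) : ursellFour J β x t z y = ursellFour J β x y z t := by
  have h4 : fourCorrelation J β x t z y = fourCorrelation J β x y z t := by
    rw [fourCorrelation_eq, fourCorrelation_eq, symmDiff_comm ({z} : Finset (Site d)) {y},
      symmDiff_left_comm ({t} : Finset (Site d)) {y} {z}, symmDiff_comm ({t} : Finset (Site d)) {z}]
  rw [ursellFour, ursellFour, h4, pairCorrelation_comm J β t z, pairCorrelation_comm J β t y,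
    pairCorrelation_comm J β z y]
  ring

/-- The ceiling with the pairing `(xz)(yt)`: `|U₄^β(x,y,z,t)| ≤ 2⟨σ_xσ_z⟩_β⟨σ_yσ_t⟩_β`.
[cite: AizenmanCDM2020, Theorem 5.4, eq. (5.13), p. 19] -/
theorem abs_ursellFour_le_two_mul_pairCorrelation' (hβ : 0 ≤ β) (hJ : ∀ x y, 0 ≤ J x y) (x y z t : Site d) :
    |ursellFour J β x y z t| ≤ 2 * (pairCorrelation J β x z * pairCorrelation J β y t) := by
  rw [← ursellFour_swap_yz J β x y z t]
  exact abs_ursellFour_le_two_mul_pairCorrelation J β hβ hJ x z y t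

/-- The ceiling with the pairing `(xt)(yz)`: `|U₄^β(x,y,z,t)| ≤ 2⟨σ_xσ_t⟩_β⟨σ_zσ_y⟩_β`.
[cite: AizenmanCDM2020, Theorem 5.4, eq. (5.13), p. 19] -/
theorem abs_ursellFour_le_two_mul_pairCorrelation'' (hβ : 0 ≤ β) (hJ : ∀ x y, 0 ≤ J x y) (x y z t : Site d) :
    |ursellFour J β x y z t| ≤ 2 * (pairCorrelation J β x t * pairCorrelation J β z y) := by
  rw [← ursellFour_swap_yt J β x y z t]
  exact abs_ursellFour_le_two_mul_pairCorrelation J β hβ hJ x t z y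

end LongRangeIsing

end Literature.Barriers.CriticalPhenomena

end
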